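import Summits.NavierStokesRegularity.NavierStokesRegularity.Theorems.EulerZoomLiouvillePowerGaugeEulerLiouvilleEnergySaturationMember
import Summits.NavierStokesRegularity.NavierStokesRegularity.Theorems.EulerZoomLiouvillePowerGaugeEulerLiouvilleNeedleThinCore
import Literature.Analysis.FluidPDE.LeraySeparationOfEnergyTools
import Literature.Analysis.FunctionSpaces.SobolevDomainProofs
import HarnessLib

/-!
# Crux E `PowerGaugeEulerLiouville` (stmt-NavierStokesRegularity-19832) — needle log-capacity portrait,
# MEMBER SIDE: the inputs of the thin-core kernel for a `C¹` exactly self-similar class member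

Route №10 `EulerZoomLiouville` (NavierStokesRegularity), crux E, THE ONE STATEMENT `stub_selfSimilarC2Needle`
(skeleton of record `Cruxes/PowerGaugeEulerLiouville/Lines/birth.lean`, interim LEAD ns-typeII-p2 g10; needle
log-capacity portrait, RESIDUE-MEMO-19832-g10 §5.2, LEAD assignment 2026-08-28T09:06:47Z, file 2/2).

The profile-level kernel `NeedleThinCore.needleThinCore` (ns-sfl-p1 g3, file `…NeedleThinCore.lean`, signature signed by
nsreg-p2 g31 09:14:07Z) consumes two inputs of a `C¹` profile `V : ℝ³ → ℝ³`:

* (A) the velocity-mass growth `∫⁻_{B_L} ‖V‖ₑ² ≤ c · L^{1−2ρ}` for all `L > 0`;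
* (E) the OPERATOR-NORM gradient weight `∫⁻ ‖fderiv ℝ V y‖ₑ² · ‖y‖^{ρ−1} ≤ C`.

This file produces both from the crux hypotheses of a class member (suitable weak Euler solution on `ℝ³ × (−∞,0)` with
weak spatial gradient `H` and the three power gauges `a^{2ρ} A + a^ρ E + a^{2ρ} D ≤ c`) that is exactly self-similar with
a `C¹` profile: `EnergySaturation.profileData_of_selfSimilar` gives (A) verbatim and the E-weight for the weak gradient
`G` in Frobenius norm; the weak gradient of a `C¹` map is its classical derivative a.e.
(`HasWeakFDerivOn.unique_holds` + `HasWeakFDerivOn.of_contDiff_holds`) and `‖·‖²_op ≤ |·|²_F`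
(`norm_sq_le_frobeniusNormSq`), whence (E) with `C = (1−ρ)/(2+ρ) · c`.

* `lintegral_fderiv_sq_weight_le_of_weak` — profile level: Frobenius weak E-weight `≤ B` ⇒ op-norm classical E-weight `≤ B`;
* `selfSimilar_needle_inputs` — member level: (A) ∧ (E);
* `selfSimilar_needleThinCore` — §2, the MEMBER COROLLARY: crux binders + exact self-similarity + `C¹` profile ⇒ the thin-core
  portrait of `NeedleThinCore.needleThinCore` (ns-sfl-p1 g3 / nsreg-p2 g31) verbatim.

WHAT THIS IS NOT: not NS, not E, no stub closes — bookkeeping feeding a kernel PORTRAIT of the needle of THE ONE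
STATEMENT; 19832 OPEN.  [folklore]
-/

noncomputable section

set_option linter.dupNamespace false

open MeasureTheory Set Filter Topology Metric Function TopologicalSpace
open scoped ENNReal NNReal

namespace Summit.NavierStokesRegularity.NavierStokesRegularity.Theorems.PowerGaugeEulerLiouville.NeedleThinCore

open Literature.Analysis Literature.Analysis.FluidPDE Literature.Analysis.FunctionSpaces

/-- **Op-norm E-weight from the Frobenius weak E-weight.**  If `V ∈ C¹(ℝ³; ℝ³)` has weak gradient `G` on `ℝ³` and
`∫⁻ |G(y)|²_F ‖y‖^{ρ−1} dy ≤ B`, then `∫⁻ ‖fderiv ℝ V y‖² ‖y‖^{ρ−1} dy ≤ B`: the weak gradient of a `C¹` map is its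
classical derivative a.e., and the operator norm is dominated by the Frobenius norm. [folklore] -/
theorem lintegral_fderiv_sq_weight_le_of_weak {ρ : ℝ}
    {V : EuclideanSpace ℝ (Fin 3) → EuclideanSpace ℝ (Fin 3)}
    {G : EuclideanSpace ℝ (Fin 3) → EuclideanSpace ℝ (Fin 3) →L[ℝ] EuclideanSpace ℝ (Fin 3)} (hV : ContDiff ℝ 1 V)
    (hG : HasWeakFDerivOn (⊤ : Opens (EuclideanSpace ℝ (Fin 3))) volume V G) {B : ℝ≥0∞}
    (hE : ∫⁻ y, ENNReal.ofReal (frobeniusNormSq (G y)) * ENNReal.ofReal (‖y‖ ^ (ρ - 1)) ≤ B) :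
    ∫⁻ y, ‖fderiv ℝ V y‖ₑ ^ 2 * ENNReal.ofReal (‖y‖ ^ (ρ - 1)) ≤ B := by
  -- the weak gradient is the classical one, a.e.
  have hae : G =ᵐ[volume] fderiv ℝ V := by
    have h := HasWeakFDerivOn.unique_holds hG (HasWeakFDerivOn.of_contDiff_holds ⊤ volume hV)
    rwa [Opens.coe_top, Measure.restrict_univ] at h
  refine le_trans (lintegral_mono_ae ?_) hE
  filter_upwards [hae] with y hy
  have e1 : ‖fderiv ℝ V y‖ₑ ^ 2 = ENNReal.ofReal (‖fderiv ℝ V y‖ ^ 2) := by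
    rw [← ofReal_norm, ENNReal.ofReal_pow (norm_nonneg _)]
  rw [e1, hy]
  exact mul_le_mul' (ENNReal.ofReal_le_ofReal (norm_sq_le_frobeniusNormSq _)) le_rfl

/-- **THE TWO NEEDLE INPUTS OF A `C¹` EXACTLY SELF-SIMILAR CLASS MEMBER** (crux hypotheses verbatim + exact
self-similarity of the velocity and pressure + `V ∈ C¹`, `0 < ρ < 1`):
(A) `∫⁻_{B_L} ‖V‖ₑ² ≤ c · L^{1−2ρ}` for every `L > 0`, and
(E) `∫⁻ ‖fderiv ℝ V y‖ₑ² ‖y‖^{ρ−1} dy ≤ (1−ρ)/(2+ρ) · c` —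
exactly the hypotheses `hA`, `hE` of the profile-level thin-core kernel `NeedleThinCore.needleThinCore`
(with `C = (1−ρ)/(2+ρ)·c`). [folklore] -/
theorem selfSimilar_needle_inputs {ρ : ℝ} (hρ : 0 < ρ) (hρ1 : ρ < 1)
    {u : ℝ → EuclideanSpace ℝ (Fin 3) → EuclideanSpace ℝ (Fin 3)} {p : ℝ → EuclideanSpace ℝ (Fin 3) → ℝ}
    {H : ℝ → EuclideanSpace ℝ (Fin 3) → EuclideanSpace ℝ (Fin 3) →L[ℝ] EuclideanSpace ℝ (Fin 3)} {c : ℝ≥0}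
    (hsw : IsSuitableWeakSolutionOn (slab (EuclideanSpace ℝ (Fin 3)) (Iio 0) isOpen_Iio) 0 0 u p)
    (hH : HasWeakSpatialGradientOn (slab (EuclideanSpace ℝ (Fin 3)) (Iio 0) isOpen_Iio) u H)
    (hgauge : ∀ a : ℝ, 0 < a →
      ENNReal.ofReal (a ^ (2 * ρ)) * cknA a (0 : ℝ × EuclideanSpace ℝ (Fin 3)) u +
          ENNReal.ofReal (a ^ ρ) * cknE a (0 : ℝ × EuclideanSpace ℝ (Fin 3)) H +
        ENNReal.ofReal (a ^ (2 * ρ)) * cknD a (0 : ℝ × EuclideanSpace ℝ (Fin 3)) p ≤ (c : ℝ≥0∞))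
    {V : EuclideanSpace ℝ (Fin 3) → EuclideanSpace ℝ (Fin 3)} {P : EuclideanSpace ℝ (Fin 3) → ℝ}
    (hu : ∀ τ : ℝ, τ < 0 → u τ = selfSimilarCollapse (1 / (2 + ρ)) 0 V τ)
    (hp : ∀ τ : ℝ, τ < 0 → p τ = selfSimilarCollapsePressure (1 / (2 + ρ)) 0 P τ)
    (hV : ContDiff ℝ 1 V) :
    (∀ L : ℝ, 0 < L → ∫⁻ y in ball (0 : EuclideanSpace ℝ (Fin 3)) L, ‖V y‖ₑ ^ 2 ≤
        (c : ℝ≥0∞) * ENNReal.ofReal (L ^ (1 - 2 * ρ))) ∧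
      ∫⁻ y, ‖fderiv ℝ V y‖ₑ ^ 2 * ENNReal.ofReal (‖y‖ ^ (ρ - 1)) ≤
        ENNReal.ofReal ((1 - ρ) / (2 + ρ) * c) := by
  obtain ⟨G, -, -, -, -, hVG, hA, hE, -⟩ := EnergySaturation.profileData_of_selfSimilar hρ hρ1 hsw hH hgauge hu hp
  refine ⟨hA, (lintegral_fderiv_sq_weight_le_of_weak hV hVG hE).trans (le_of_eq ?_)⟩
  have h0 : (0 : ℝ) ≤ (1 - ρ) / (2 + ρ) := by
    have : 0 ≤ 1 - ρ := by linarith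
    positivity
  rw [ENNReal.ofReal_mul h0, ENNReal.ofReal_coe_nnreal]

/-! ## The member corollary of the thin-core kernel (§2, appended once `NeedleThinCore.needleThinCore` landed) -/

open scoped RealInnerProductSpace in
open NeedleDiscChart in
/-- **NEEDLE THIN-CORE PORTRAIT OF A `C¹` EXACTLY SELF-SIMILAR CLASS MEMBER** (member corollary of ns-sfl-p1 g3's
`NeedleThinCore.needleThinCore`, signature by nsreg-p2 g31; RESIDUE-MEMO-19832-g10 §5.2, ROUND-35 §1).  Under the crux hypotheses
verbatim (suitable weak Euler solution on `ℝ³ × (−∞,0)`, weak spatial gradient `H`, power gauges `a^{2ρ}A + a^ρ E + a^{2ρ}D ≤ c`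
for all `a > 0`), exact self-similarity `u(τ) = (−τ)^{γ−1} V((−τ)^{−γ} ·)`, `p(τ) = (−τ)^{2γ−2} P((−τ)^{−γ} ·)`, `γ = 1/(2+ρ)`,
a `C¹` profile `V`, `0 < ρ < 1`, and any `C > 0` with `(1−ρ)/(2+ρ)·c ≤ C`: for every core strength `κ > 0` there is `L₀ > 0`
such that for all `L ≥ L₀`, every orthonormal frame `(e, e₁, e₂)`, every base distance `s₀ ∈ [L, 2L]` and every `w ∈ (0, L]`,
if the radial inflow satisfies `−⟪e, V⟫ ≥ κ s₀` on the solid cylinder `{t•e + discChart z : t ∈ (s₀, s₀ + L/2), ‖z‖ ≤ w}`,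
then `w ≤ 16 √(c+1) κ⁻¹ · L^{−1−ρ} · exp(−κ² L^{2+ρ} / (96 C))` — the fast-inflow core of the needle is super-exponentially
thin.  (`C` is free with `(1−ρ)/(2+ρ)c ≤ C` rather than `= (1−ρ)/(2+ρ)c` because the kernel wants `0 < C` and `c = 0` is
allowed.)  Inputs (A), (E) from `selfSimilar_needle_inputs`. [folklore] -/
theorem selfSimilar_needleThinCore {ρ : ℝ} (hρ : 0 < ρ) (hρ1 : ρ < 1)
    {u : ℝ → EuclideanSpace ℝ (Fin 3) → EuclideanSpace ℝ (Fin 3)} {p : ℝ → EuclideanSpace ℝ (Fin 3) → ℝ}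
    {H : ℝ → EuclideanSpace ℝ (Fin 3) → EuclideanSpace ℝ (Fin 3) →L[ℝ] EuclideanSpace ℝ (Fin 3)} {c : ℝ≥0}
    (hsw : IsSuitableWeakSolutionOn (slab (EuclideanSpace ℝ (Fin 3)) (Iio 0) isOpen_Iio) 0 0 u p)
    (hH : HasWeakSpatialGradientOn (slab (EuclideanSpace ℝ (Fin 3)) (Iio 0) isOpen_Iio) u H)
    (hgauge : ∀ a : ℝ, 0 < a →
      ENNReal.ofReal (a ^ (2 * ρ)) * cknA a (0 : ℝ × EuclideanSpace ℝ (Fin 3)) u +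
          ENNReal.ofReal (a ^ ρ) * cknE a (0 : ℝ × EuclideanSpace ℝ (Fin 3)) H +
        ENNReal.ofReal (a ^ (2 * ρ)) * cknD a (0 : ℝ × EuclideanSpace ℝ (Fin 3)) p ≤ (c : ℝ≥0∞))
    {V : EuclideanSpace ℝ (Fin 3) → EuclideanSpace ℝ (Fin 3)} {P : EuclideanSpace ℝ (Fin 3) → ℝ}
    (hu : ∀ τ : ℝ, τ < 0 → u τ = selfSimilarCollapse (1 / (2 + ρ)) 0 V τ)
    (hp : ∀ τ : ℝ, τ < 0 → p τ = selfSimilarCollapsePressure (1 / (2 + ρ)) 0 P τ)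
    (hV : ContDiff ℝ 1 V) {C : ℝ} (hC : 0 < C) (hcC : (1 - ρ) / (2 + ρ) * (c : ℝ) ≤ C) {κ : ℝ} (hκ : 0 < κ) :
    ∃ L₀ : ℝ, 0 < L₀ ∧ ∀ L : ℝ, L₀ ≤ L →
      ∀ e e₁ e₂ : EuclideanSpace ℝ (Fin 3), Orthonormal ℝ ![e, e₁, e₂] →
      ∀ s₀ : ℝ, L ≤ s₀ → s₀ ≤ 2 * L →
      ∀ w : ℝ, 0 < w → w ≤ L →
        (∀ t ∈ Ioo s₀ (s₀ + L / 2), ∀ z : ℂ, ‖z‖ ≤ w → κ * s₀ ≤ -⟪e, V (discChart (t • e) e₁ e₂ z)⟫) →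
        w ≤ 16 * Real.sqrt ((c : ℝ) + 1) / κ * L ^ (-1 - ρ) * Real.exp (-(κ ^ 2 * L ^ (2 + ρ) / (96 * C))) := by
  obtain ⟨hA, hE⟩ := selfSimilar_needle_inputs hρ hρ1 hsw hH hgauge hu hp hV
  exact needleThinCore hρ hρ1 hC hV hA (hE.trans (ENNReal.ofReal_le_ofReal hcC)) hκ

end Summit.NavierStokesRegularity.NavierStokesRegularity.Theorems.PowerGaugeEulerLiouville.NeedleThinCore

end
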